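import Summits.ResolutionOfSingularities.ResolutionOfSingularities.Theorems.PurelyInseparableDim4ChartAtlasSNCFarShearAlgebra
import Summits.ResolutionOfSingularities.ResolutionOfSingularities.Theorems.PurelyInseparableDim4ChartAtlasSNCJacobianIndexed
import HarnessLib

/-!
# Purely inseparable four-folds `z^p + F(x₁, …, x₄)`: the far good SHEAR chart WITH PARALLEL MEMBERS — hyperplanes and far quadrics indexed by
# PAIRS (index, constant) (S3-N2 positive side; cell `res-dim4-pi`, typ-2 g6)

[OURS · counted 0] (D-0157 DOOR 2; DR-157-C; typ-2 HANDOFF OPEN item «parallel members of equal index»). p702981's far good shear chart keys the far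
quadrics by their index. This file re-proves it with PAIRS: on a shear chart `x_l` (`l ∈ S ∖ S'`, `l ≠ j`; centre `V(y_0, y_T)`, `j, l ∉ T`) the members
are `⊤`, hyperplanes `(y_m + a)·𝒪` (`(m, a) ∈ H`, any finite set), GENUINELY sheared near members `(y_m + b_m·y_j)·𝒪` (`m ∈ sh`, `b_m ≠ 0`; a near member
with `b_m = 0` is the hyperplane `(m⁺, 0)`), far quadrics `F_{j,d} = (y_j·y_l + d)·𝒪` (`d ∈ FJ`, several allowed) and `F_{i,d} = ((yᵢ + bᵢ·y_j)·y_l + d)·𝒪`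
(`(i, d) ∈ FQ`, several per index allowed). PROVED here (no `sorry`, no new axiom) over the indexed engine p707152:

* **`hasSNCWith_𝓘Λ_of_forall_mem_far_shear_pairs`** — under `|B_near| ≤ 1`, the dictionary provenance of the hyperplanes and pairwise distinct ACTIVE
  far heights (`d ≠ bᵢ·d'` for `(i, d) ∈ FQ` active and `d' ∈ FJ`; `d·b_k ≠ d'·bᵢ` for distinct active pairs), `HasSNCWith E (𝓘Λ 4 K ({0} ∪ T⁺))`.

Nothing here is a statement about resolution of singularities in dimension ≥ 4 / characteristic `p` (NOT proved anywhere in this programme).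
bears_on: LADDER-RESOLUTION:D157-DOOR2 (res-dim4-pi). Supports stmt-ResolutionOfSingularities-16155 (helper, S3-N2 positive side, parallel members).
-/

-- every declaration of this summit lives under `Summit.ResolutionOfSingularities.ResolutionOfSingularities`
-- (summit = problem), which the duplicate-namespace linter flags; house convention (cf. the Target file).
set_option linter.dupNamespace false

noncomputable section

open MvPolynomial CategoryTheory AlgebraicGeometry Opposite TopologicalSpace
open AlgebraicGeometry.Scheme.IdealSheafData (ofIdealTop)

namespace Summit.ResolutionOfSingularities.ResolutionOfSingularities.Theorems.PIDim4

open Literature.AlgebraicGeometry.Resolution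
open Literature.AlgebraicGeometry.Resolution.AffinePointBlowup (P A γ coord Wtop ξ)

namespace ChartDictionary

variable {K : Type} [Field K] {T : Finset (Fin 4)} {j l : Fin 4} {b : Fin 4 → K}

/-- **THE FAR GOOD SHEAR CHART WITH PARALLEL MEMBERS.** Centre `V(y_0, y_T)`, `j ∉ T`, `j ≠ l` (`l ∉ T` is not even needed). Members: `⊤`; hyperplanes `(m, a) ∈ H` (index `j⁺` only
with `a = 0`; no index `m⁺`, `m ∈ sh`; index `i⁺` of a far pair only with `a = 0 ∧ bᵢ = 0`); sheared `(y_m + b_m·y_j)·𝒪`, `m ∈ sh`, `b_m ≠ 0`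
(`j, l ∉ sh`); `F_{j,d}`, `d ∈ FJ` (`d ≠ 0`); `F_{i,d}`, `(i, d) ∈ FQ` (`i ≠ j, l`; `d ≠ 0`). Hypotheses: `|B| ≤ 1` (`(j⁺, 0) ∈ H →` no `m ∈ sh ∩ T`; at most
one `m ∈ sh ∩ T`), heights `d ≠ bᵢ·d'` (`(i, d) ∈ FQ`, `i ∈ T`, `bᵢ ≠ 0`, `d' ∈ FJ`) and `d·b_k ≠ d'·bᵢ` (distinct active pairs). -/
theorem hasSNCWith_𝓘Λ_of_forall_mem_far_shear_pairs (hjT : j ∉ T) (hjl : j ≠ l) (H : Finset (Fin (4 + 1) × K))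
    (sh : Finset (Fin 4)) (FJ : Finset K) (FQ : Finset (Fin 4 × K)) (hjsh : j ∉ sh) (hlsh : l ∉ sh) (hshb : ∀ m ∈ sh, b m ≠ 0)
    (hFJ : ∀ d ∈ FJ, d ≠ 0) (hFQ : ∀ id ∈ FQ, id.1 ≠ j ∧ id.1 ≠ l ∧ id.2 ≠ 0)
    (hHj : ∀ a : K, (j.succ, a) ∈ H → a = 0) (hHsh : ∀ m ∈ sh, ∀ a : K, (m.succ, a) ∉ H)
    (hHfs : ∀ id ∈ FQ, ∀ a : K, (id.1.succ, a) ∈ H → a = 0 ∧ b id.1 = 0)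
    (hB1 : (j.succ, (0 : K)) ∈ H → ∀ m ∈ sh, m ∉ T) (hB2 : ∀ m ∈ sh, ∀ m' ∈ sh, m ∈ T → m' ∈ T → m = m')
    (hC2 : ∀ id ∈ FQ, id.1 ∈ T → b id.1 ≠ 0 → ∀ d' ∈ FJ, id.2 ≠ b id.1 * d')
    (hC3 : ∀ id ∈ FQ, ∀ kd ∈ FQ, id ≠ kd → id.1 ∈ T → kd.1 ∈ T → b id.1 ≠ 0 → b kd.1 ≠ 0 → id.2 * b kd.1 ≠ kd.2 * b id.1)
    {E : List (Scheme.IdealSheafData (P 4 K))}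
    (hE : ∀ D ∈ E, D = ⊤ ∨ (∃ ma ∈ H, D = ofIdealTop (Ideal.span {(γ 4 K).symm (X ma.1 + C ma.2)})) ∨
      (∃ m ∈ sh, D = ofIdealTop (Ideal.span {(γ 4 K).symm (X m.succ + C (b m) * X j.succ)})) ∨
      (∃ d ∈ FJ, D = ofIdealTop (Ideal.span {(γ 4 K).symm (X j.succ * X l.succ + C d)})) ∨
      ∃ id ∈ FQ, D = ofIdealTop (Ideal.span {(γ 4 K).symm ((X id.1.succ + C (b id.1) * X j.succ) * X l.succ + C id.2)})) :
    HasSNCWith E (AffineCoordBlowup.𝓘Λ 4 K (insert 0 (Fin.succ '' (T : Set (Fin 4))))) := by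
  classical
  set Λ : Set (Fin (4 + 1)) := insert 0 (Fin.succ '' (T : Set (Fin 4))) with hΛ
  have hmemΛ : ∀ i : Fin 4, i.succ ∈ Λ ↔ i ∈ T := fun i => succ_mem_centreVars_iff T i
  have hjΛ : j.succ ∉ Λ := fun h => hjT ((hmemΛ j).mp h)
  -- indices: hyperplanes ⊕ sheared ⊕ far `j` ⊕ far pairs
  let f : (Fin (4 + 1) × K) ⊕ Fin 4 ⊕ K ⊕ (Fin 4 × K) → A 4 K :=
    Sum.elim (fun ma => X ma.1 + C ma.2) (Sum.elim (fun m => X m.succ + C (b m) * X j.succ) (Sum.elim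
      (fun d => X j.succ * X l.succ + C d) (fun id => (X id.1.succ + C (b id.1) * X j.succ) * X l.succ + C id.2)))
  let I : Finset ((Fin (4 + 1) × K) ⊕ Fin 4 ⊕ K ⊕ (Fin 4 × K)) := H.disjSum (sh.disjSum (FJ.disjSum FQ))
  let G : Finset ((Fin (4 + 1) × K) ⊕ Fin 4 ⊕ K ⊕ (Fin 4 × K)) := ((Set.toFinite Λ).toFinset.image fun m => (m, (0 : K))).image Sum.inl
  have hGmem : ∀ a, a ∈ G ↔ ∃ m ∈ Λ, a = Sum.inl (m, 0) := by
    intro a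
    simp only [G, Finset.mem_image, Set.Finite.mem_toFinset]
    constructor
    · rintro ⟨_, ⟨m, hm, rfl⟩, rfl⟩; exact ⟨m, hm, rfl⟩
    · rintro ⟨m, hm, rfl⟩; exact ⟨(m, 0), ⟨m, hm, rfl⟩, rfl⟩
  have hspan : Ideal.span (f '' (G : Set _)) = Ideal.span (X '' Λ) := by
    congr 1
    ext q
    constructor
    · rintro ⟨a, ha, rfl⟩
      obtain ⟨m, hm, rfl⟩ := (hGmem a).mp (Finset.mem_coe.mp ha)
      exact ⟨m, hm, by change X m = X m + C 0; rw [C_0, add_zero]⟩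
    · rintro ⟨m, hm, rfl⟩
      exact ⟨Sum.inl (m, 0), Finset.mem_coe.mpr ((hGmem _).mpr ⟨m, hm, rfl⟩), by change X m + C 0 = X m; rw [C_0, add_zero]⟩
  let act : P 4 K → Fin 4 → Prop := fun x i => i.succ ∈ Λ ∧ ∀ m ∈ Λ, (X m : A 4 K) ∈ x.asIdeal
  let v : P 4 K → (Fin (4 + 1) × K) ⊕ Fin 4 ⊕ K ⊕ (Fin 4 × K) → Fin (4 + 1) := fun x =>
    Sum.elim (fun ma => ma.1) (Sum.elim (fun m => if act x m then j.succ else m.succ) (Sum.elim (fun _ => j.succ)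
      (fun id => if act x id.1 then j.succ else id.1.succ)))
  let ρ : P 4 K → (Fin (4 + 1) × K) ⊕ Fin 4 ⊕ K ⊕ (Fin 4 × K) → ℕ := fun x =>
    Sum.elim (fun _ => 0) (Sum.elim (fun m => if act x m then 2 else 3) (Sum.elim (fun _ => 1) (fun id => if act x id.1 then 1 else 4)))
  have hfamily : ∀ (x : P 4 K) a, (a ∈ I ∧ f a ∈ x.asIdeal ∨ a ∈ G ∧ ∀ g ∈ G, f g ∈ x.asIdeal) → f a ∈ x.asIdeal ∧
      ((∃ ma, a = Sum.inl ma ∧ (ma ∈ H ∨ ma.2 = 0 ∧ ma.1 ∈ Λ ∧ ∀ m ∈ Λ, (X m : A 4 K) ∈ x.asIdeal)) ∨ (∃ m ∈ sh, a = Sum.inr (Sum.inl m)) ∨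
        (∃ d ∈ FJ, a = Sum.inr (Sum.inr (Sum.inl d))) ∨ ∃ id ∈ FQ, a = Sum.inr (Sum.inr (Sum.inr id))) := by
    rintro x a (⟨haI, ha𝔭⟩ | ⟨haG, hall⟩)
    · refine ⟨ha𝔭, ?_⟩
      simp only [I, Finset.mem_disjSum] at haI
      rcases haI with ⟨ma, hma, rfl⟩ | ⟨_, haI, rfl⟩
      · exact Or.inl ⟨ma, rfl, Or.inl hma⟩
      rcases haI with ⟨m, hm, rfl⟩ | ⟨_, haI, rfl⟩
      · exact Or.inr (Or.inl ⟨m, hm, rfl⟩)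
      rcases haI with ⟨d, hd, rfl⟩ | ⟨id, hid, rfl⟩
      · exact Or.inr (Or.inr (Or.inl ⟨d, hd, rfl⟩))
      · exact Or.inr (Or.inr (Or.inr ⟨id, hid, rfl⟩))
    · obtain ⟨m, hm, rfl⟩ := (hGmem a).mp haG
      have hallΛ : ∀ m ∈ Λ, (X m : A 4 K) ∈ x.asIdeal := fun m' hm' => by
        have h := hall _ ((hGmem _).mpr ⟨m', hm', rfl⟩)
        change (X m' + C 0 : A 4 K) ∈ x.asIdeal at h
        rwa [C_0, add_zero] at h
      exact ⟨hall _ haG, Or.inl ⟨(m, 0), rfl, Or.inr ⟨rfl, hm, hallΛ⟩⟩⟩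
  -- a hyperplane of index `j` in the family is `y_j` and comes from `H`
  have hyp_j : ∀ (x : P 4 K) (ma : Fin (4 + 1) × K), (ma ∈ H ∨ ma.2 = 0 ∧ ma.1 ∈ Λ ∧ ∀ m ∈ Λ, (X m : A 4 K) ∈ x.asIdeal) →
      (X ma.1 + C ma.2 : A 4 K) ∈ x.asIdeal → ma.1 = j.succ → (j.succ, (0 : K)) ∈ H ∧ (X j.succ : A 4 K) ∈ x.asIdeal := by
    intro x ma hma hq hj1
    have hmaH : ma ∈ H := by
      rcases hma with h | ⟨-, h, -⟩
      · exact h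
      · exact absurd (hj1 ▸ h) hjΛ
    have ha0 : ma.2 = 0 := hHj ma.2 (by rw [← hj1]; exact hmaH)
    refine ⟨by rw [← hj1, ← ha0]; exact hmaH, ?_⟩
    rw [hj1, ha0, C_0, add_zero] at hq
    exact hq
  refine hasSNCWith_𝓘Λ_of_jacobian_indexed E Λ I G f hspan ?_ ρ v ?_ ?_
  · intro D hD
    rcases hE D hD with h | ⟨ma, hma, h⟩ | ⟨m, hm, h⟩ | ⟨d, hd, h⟩ | ⟨id, hid, h⟩
    · exact Or.inl h
    · exact Or.inr ⟨Sum.inl ma, by simp [I, hma], h⟩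
    · exact Or.inr ⟨Sum.inr (Sum.inl m), by simp [I, hm], h⟩
    · exact Or.inr ⟨Sum.inr (Sum.inr (Sum.inl d)), by simp [I, hd], h⟩
    · exact Or.inr ⟨Sum.inr (Sum.inr (Sum.inr id)), by simp [I, hid], h⟩
  · -- diagonal
    intro x a ha
    obtain ⟨ha𝔭, hshape⟩ := hfamily x a ha
    rcases hshape with ⟨ma, rfl, -⟩ | ⟨m, hm, rfl⟩ | ⟨d, hd, rfl⟩ | ⟨id, hid, rfl⟩
    · change pderiv ma.1 (X ma.1 + C ma.2 : A 4 K) ∉ x.asIdeal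
      rw [pderiv_X_add_C, if_pos rfl]
      exact fun h1 => x.2.ne_top ((Ideal.eq_top_iff_one _).mpr h1)
    · have hmj : m ≠ j := fun e => hjsh (e ▸ hm)
      change pderiv (if act x m then j.succ else m.succ) (X m.succ + C (b m) * X j.succ : A 4 K) ∉ x.asIdeal
      by_cases hact : act x m
      · rw [if_pos hact, pderiv_shear_j hmj, C_mem_asIdeal_iff]
        exact hshb m hm
      · rw [if_neg hact, pderiv_shear_self hmj]
        exact fun h1 => x.2.ne_top ((Ideal.eq_top_iff_one _).mpr h1)
    · change pderiv j.succ (X j.succ * X l.succ + C d : A 4 K) ∉ x.asIdeal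
      rw [pderiv_farj_j (d := fun _ => d) hjl]
      exact (X_not_mem_of_farj_mem x (d := fun _ => d) (hFJ d hd) ha𝔭).2
    · obtain ⟨hij, hil, hd⟩ := hFQ id hid
      change pderiv (if act x id.1 then j.succ else id.1.succ) ((X id.1.succ + C (b id.1) * X j.succ) * X l.succ + C id.2 : A 4 K) ∉ x.asIdeal
      by_cases hact : act x id.1
      · rw [if_pos hact, pderiv_far_j (d := fun _ => id.2) hij hjl]
        obtain ⟨-, hbi, -⟩ := far_active x (d := fun _ => id.2) hd ha𝔭 (hact.2 _ hact.1)
        intro hmem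
        rcases x.2.mem_or_mem hmem with h1 | h1
        · exact hbi ((C_mem_asIdeal_iff x _).mp h1)
        · exact (not_mem_of_far_mem x (d := fun _ => id.2) hd ha𝔭).1 h1
      · rw [if_neg hact, pderiv_far_self (d := fun _ => id.2) hij hil]
        exact (not_mem_of_far_mem x (d := fun _ => id.2) hd ha𝔭).1
  · -- triangularity
    intro x a a' ha ha' hne hρle
    obtain ⟨ha𝔭, hshape⟩ := hfamily x a ha
    obtain ⟨ha'𝔭, hshape'⟩ := hfamily x a' ha'
    rcases hshape with ⟨ma, rfl, hma⟩ | ⟨m, hm, rfl⟩ | ⟨d, hd, rfl⟩ | ⟨id, hid, rfl⟩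
    · -- `a` a hyperplane
      change pderiv (v x a') (X ma.1 + C ma.2 : A 4 K) ∈ x.asIdeal
      rw [pderiv_X_add_C]
      split_ifs with ho
      swap
      · exact x.asIdeal.zero_mem
      exfalso
      rcases hshape' with ⟨ma', rfl, -⟩ | ⟨m', hm', rfl⟩ | ⟨d', hd', rfl⟩ | ⟨id', hid', rfl⟩
      · change ma'.1 = ma.1 at ho
        have h2 := X_add_C_eq_of_mem_of_mem x (k := ma.1) (a := ma.2) (a' := ma'.2) ha𝔭 (by rw [← ho]; exact ha'𝔭)
        exact hne (by rw [show ma = ma' from Prod.ext ho.symm h2])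
      · change (if act x m' then j.succ else m'.succ) = ma.1 at ho
        by_cases hact : act x m'
        · rw [if_pos hact] at ho
          exact hB1 (hyp_j x ma hma ha𝔭 ho.symm).1 m' hm' ((hmemΛ m').mp hact.1)
        · rw [if_neg hact] at ho
          rcases hma with h | ⟨-, hmem, hall⟩
          · exact hHsh m' hm' ma.2 (by rw [ho]; exact h)
          · exact hact ⟨ho ▸ hmem, hall⟩
      · change j.succ = ma.1 at ho
        exact (X_not_mem_of_farj_mem x (d := fun _ => d') (hFJ d' hd') ha'𝔭).1 (hyp_j x ma hma ha𝔭 ho.symm).2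
      · obtain ⟨hij', hil', hd'⟩ := hFQ id' hid'
        change (if act x id'.1 then j.succ else id'.1.succ) = ma.1 at ho
        by_cases hact : act x id'.1
        · rw [if_pos hact] at ho
          exact (far_active x (d := fun _ => id'.2) hd' ha'𝔭 (hact.2 _ hact.1)).2.2 (hyp_j x ma hma ha𝔭 ho.symm).2
        · rw [if_neg hact] at ho
          rcases hma with h | ⟨h0, hmem, hall⟩
          · obtain ⟨ha0, hb0⟩ := hHfs id' hid' ma.2 (by rw [ho]; exact h)
            have hXi : (X id'.1.succ : A 4 K) ∈ x.asIdeal := by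
              have h' := ha𝔭; change (X ma.1 + C ma.2 : A 4 K) ∈ x.asIdeal at h'; rw [← ho, ha0, C_0, add_zero] at h'; exact h'
            exact (far_active x (d := fun _ => id'.2) hd' ha'𝔭 hXi).2.1 hb0
          · exact hact ⟨ho ▸ hmem, hall⟩
    · -- `a` a sheared member
      have hmj : m ≠ j := fun e => hjsh (e ▸ hm)
      rcases hshape' with ⟨ma', rfl, -⟩ | ⟨m', hm', rfl⟩ | ⟨d', hd', rfl⟩ | ⟨id', hid', rfl⟩
      · exfalso; change (if act x m then 2 else 3) ≤ 0 at hρle; split_ifs at hρle <;> omega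
      · have hm'j : m' ≠ j := fun e => hjsh (e ▸ hm')
        have hmm' : m ≠ m' := fun e => hne (by rw [e])
        change pderiv (if act x m' then j.succ else m'.succ) (X m.succ + C (b m) * X j.succ : A 4 K) ∈ x.asIdeal
        by_cases hact' : act x m'
        · exfalso
          have hact : act x m := by
            change (if act x m then 2 else 3) ≤ (if act x m' then 2 else 3) at hρle
            by_contra h; rw [if_neg h, if_pos hact'] at hρle; omega
          exact hmm' (hB2 m hm m' hm' ((hmemΛ m).mp hact.1) ((hmemΛ m').mp hact'.1))
        · rw [if_neg hact', pderiv_shear_of_ne (fun e => hmm' (Fin.succ_injective _ e).symm) (fun e => hm'j (Fin.succ_injective _ e))]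
          exact x.asIdeal.zero_mem
      · exfalso; change (if act x m then 2 else 3) ≤ 1 at hρle; split_ifs at hρle <;> omega
      · obtain ⟨hij', -, hd'⟩ := hFQ id' hid'
        change pderiv (if act x id'.1 then j.succ else id'.1.succ) (X m.succ + C (b m) * X j.succ : A 4 K) ∈ x.asIdeal
        by_cases hact' : act x id'.1
        · exfalso
          change (if act x m then 2 else 3) ≤ (if act x id'.1 then 1 else 4) at hρle
          rw [if_pos hact'] at hρle; split_ifs at hρle <;> omega
        · rw [if_neg hact']
          by_cases hmi : m = id'.1
          · exfalso
            have h' := ha'𝔭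
            change ((X id'.1.succ + C (b id'.1) * X j.succ) * X l.succ + C id'.2 : A 4 K) ∈ x.asIdeal at h'
            rw [← hmi] at h'
            exact (not_mem_of_far_mem x (d := fun _ => id'.2) (i := m) hd' h').2 ha𝔭
          · rw [pderiv_shear_of_ne (fun e => hmi (Fin.succ_injective _ e).symm) (fun e => hij' (Fin.succ_injective _ e))]
            exact x.asIdeal.zero_mem
    · -- `a = F_{j,d}`
      obtain ⟨hXj, -⟩ := X_not_mem_of_farj_mem x (d := fun _ => d) (hFJ d hd) ha𝔭
      rcases hshape' with ⟨ma', rfl, -⟩ | ⟨m', hm', rfl⟩ | ⟨d', hd', rfl⟩ | ⟨id', hid', rfl⟩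
      · exfalso; change (1 : ℕ) ≤ 0 at hρle; omega
      · have hm'j : m' ≠ j := fun e => hjsh (e ▸ hm')
        have hm'l : m' ≠ l := fun e => hlsh (e ▸ hm')
        change pderiv (if act x m' then j.succ else m'.succ) (X j.succ * X l.succ + C d : A 4 K) ∈ x.asIdeal
        by_cases hact' : act x m'
        · exact absurd (X_j_mem_of_shear_mem x (hshb m' hm') ha'𝔭 (hact'.2 _ hact'.1)) hXj
        · rw [if_neg hact', pderiv_farj_of_ne (d := fun _ => d) (fun e => hm'j (Fin.succ_injective _ e)) (fun e => hm'l (Fin.succ_injective _ e))]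
          exact x.asIdeal.zero_mem
      · -- two parallel `F_j` never meet
        exfalso
        have h1 : (X j.succ * X l.succ + C d - (X j.succ * X l.succ + C d') : A 4 K) ∈ x.asIdeal := x.asIdeal.sub_mem ha𝔭 ha'𝔭
        rw [add_sub_add_left_eq_sub, ← C_sub, C_mem_asIdeal_iff, sub_eq_zero] at h1
        exact hne (by rw [h1])
      · obtain ⟨hij', hil', hd'⟩ := hFQ id' hid'
        change pderiv (if act x id'.1 then j.succ else id'.1.succ) (X j.succ * X l.succ + C d : A 4 K) ∈ x.asIdeal
        by_cases hact' : act x id'.1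
        · exfalso
          have hXi : (X id'.1.succ : A 4 K) ∈ x.asIdeal := hact'.2 _ hact'.1
          obtain ⟨hi', hbi', -⟩ := far_active x (d := fun _ => id'.2) hd' ha'𝔭 hXi
          refine hC2 id' hid' ((hmemΛ _).mp hact'.1) hbi' d hd ?_
          have h1 := x.asIdeal.sub_mem (x.asIdeal.mul_mem_left (C (b id'.1)) ha𝔭) hi'
          change (C (b id'.1) * (X j.succ * X l.succ + C d) - (C (b id'.1) * (X j.succ * X l.succ) + C id'.2) : A 4 K) ∈ x.asIdeal at h1
          have e1 : (C (b id'.1) * (X j.succ * X l.succ + C d) - (C (b id'.1) * (X j.succ * X l.succ) + C id'.2) : A 4 K) = C (b id'.1 * d - id'.2) := by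
            simp only [C_sub, C_mul]; ring
          rw [e1, C_mem_asIdeal_iff, sub_eq_zero] at h1
          exact h1.symm
        · rw [if_neg hact', pderiv_farj_of_ne (d := fun _ => d) (fun e => hij' (Fin.succ_injective _ e)) (fun e => hil' (Fin.succ_injective _ e))]
          exact x.asIdeal.zero_mem
    · -- `a = F_{i,d}`
      obtain ⟨hij, hil, hdd⟩ := hFQ id hid
      rcases hshape' with ⟨ma', rfl, -⟩ | ⟨m', hm', rfl⟩ | ⟨d', hd', rfl⟩ | ⟨id', hid', rfl⟩
      · exfalso; change (if act x id.1 then 1 else 4) ≤ 0 at hρle; split_ifs at hρle <;> omega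
      · have hm'j : m' ≠ j := fun e => hjsh (e ▸ hm')
        have hm'l : m' ≠ l := fun e => hlsh (e ▸ hm')
        change pderiv (if act x m' then j.succ else m'.succ) ((X id.1.succ + C (b id.1) * X j.succ) * X l.succ + C id.2 : A 4 K) ∈ x.asIdeal
        by_cases hact' : act x m'
        · exfalso
          by_cases hact : act x id.1
          · exact (far_active x (d := fun _ => id.2) hdd ha𝔭 (hact.2 _ hact.1)).2.2 (X_j_mem_of_shear_mem x (hshb m' hm') ha'𝔭 (hact'.2 _ hact'.1))
          · change (if act x id.1 then 1 else 4) ≤ (if act x m' then 2 else 3) at hρle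
            rw [if_neg hact, if_pos hact'] at hρle; omega
        · rw [if_neg hact']
          by_cases hmi : m' = id.1
          · exfalso
            have h' := ha𝔭
            change ((X id.1.succ + C (b id.1) * X j.succ) * X l.succ + C id.2 : A 4 K) ∈ x.asIdeal at h'
            rw [← hmi] at h'
            exact (not_mem_of_far_mem x (d := fun _ => id.2) (i := m') hdd h').2 ha'𝔭
          · rw [pderiv_far_of_ne (d := fun _ => id.2) (fun e => hmi (Fin.succ_injective _ e)) (fun e => hm'j (Fin.succ_injective _ e))
              (fun e => hm'l (Fin.succ_injective _ e))]
            exact x.asIdeal.zero_mem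
      · change pderiv j.succ ((X id.1.succ + C (b id.1) * X j.succ) * X l.succ + C id.2 : A 4 K) ∈ x.asIdeal
        exfalso
        have hact : act x id.1 := by
          change (if act x id.1 then 1 else 4) ≤ 1 at hρle
          by_contra h; rw [if_neg h] at hρle; omega
        have hXi : (X id.1.succ : A 4 K) ∈ x.asIdeal := hact.2 _ hact.1
        obtain ⟨hi, hbi, -⟩ := far_active x (d := fun _ => id.2) hdd ha𝔭 hXi
        refine hC2 id hid ((hmemΛ _).mp hact.1) hbi d' hd' ?_
        have h1 := x.asIdeal.sub_mem (x.asIdeal.mul_mem_left (C (b id.1)) ha'𝔭) hi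
        change (C (b id.1) * (X j.succ * X l.succ + C d') - (C (b id.1) * (X j.succ * X l.succ) + C id.2) : A 4 K) ∈ x.asIdeal at h1
        have e1 : (C (b id.1) * (X j.succ * X l.succ + C d') - (C (b id.1) * (X j.succ * X l.succ) + C id.2) : A 4 K) = C (b id.1 * d' - id.2) := by
          simp only [C_sub, C_mul]; ring
        rw [e1, C_mem_asIdeal_iff, sub_eq_zero] at h1
        exact h1.symm
      · obtain ⟨hij', hil', hd'⟩ := hFQ id' hid'
        change pderiv (if act x id'.1 then j.succ else id'.1.succ) ((X id.1.succ + C (b id.1) * X j.succ) * X l.succ + C id.2 : A 4 K) ∈ x.asIdeal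
        by_cases hact' : act x id'.1
        · exfalso
          have hact : act x id.1 := by
            change (if act x id.1 then 1 else 4) ≤ (if act x id'.1 then 1 else 4) at hρle
            by_contra h; rw [if_neg h, if_pos hact'] at hρle; omega
          have hXi : (X id.1.succ : A 4 K) ∈ x.asIdeal := hact.2 _ hact.1
          have hXi' : (X id'.1.succ : A 4 K) ∈ x.asIdeal := hact'.2 _ hact'.1
          obtain ⟨hi, hbi, -⟩ := far_active x (d := fun _ => id.2) hdd ha𝔭 hXi
          obtain ⟨hi', hbi', -⟩ := far_active x (d := fun _ => id'.2) hd' ha'𝔭 hXi'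
          refine hC3 id hid id' hid' (fun e => hne (by rw [e])) ((hmemΛ _).mp hact.1) ((hmemΛ _).mp hact'.1) hbi hbi' ?_
          have h1 := x.asIdeal.sub_mem (x.asIdeal.mul_mem_left (C (b id'.1)) hi) (x.asIdeal.mul_mem_left (C (b id.1)) hi')
          change (C (b id'.1) * (C (b id.1) * (X j.succ * X l.succ) + C id.2) - C (b id.1) * (C (b id'.1) * (X j.succ * X l.succ) + C id'.2) : A 4 K) ∈
            x.asIdeal at h1
          have e1 : (C (b id'.1) * (C (b id.1) * (X j.succ * X l.succ) + C id.2) - C (b id.1) * (C (b id'.1) * (X j.succ * X l.succ) + C id'.2) :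
              A 4 K) = C (id.2 * b id'.1 - id'.2 * b id.1) := by
            simp only [C_sub, C_mul]; ring
          rw [e1, C_mem_asIdeal_iff, sub_eq_zero] at h1
          exact h1
        · rw [if_neg hact']
          by_cases hii : id'.1 = id.1
          · exfalso
            have h1 : (((X id.1.succ + C (b id.1) * X j.succ) * X l.succ + C id.2) -
                ((X id'.1.succ + C (b id'.1) * X j.succ) * X l.succ + C id'.2) : A 4 K) ∈ x.asIdeal := x.asIdeal.sub_mem ha𝔭 ha'𝔭
            have e1 : (((X id.1.succ + C (b id.1) * X j.succ) * X l.succ + C id.2) -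
                ((X id'.1.succ + C (b id'.1) * X j.succ) * X l.succ + C id'.2) : A 4 K) = C (id.2 - id'.2) := by rw [hii, C_sub]; ring
            rw [e1, C_mem_asIdeal_iff, sub_eq_zero] at h1
            exact hne (by rw [show id = id' from Prod.ext hii.symm h1])
          · rw [pderiv_far_of_ne (d := fun _ => id.2) (fun e => hii (Fin.succ_injective _ e)) (fun e => hij' (Fin.succ_injective _ e))
              (fun e => hil' (Fin.succ_injective _ e))]
            exact x.asIdeal.zero_mem

end ChartDictionary

end Summit.ResolutionOfSingularities.ResolutionOfSingularities.Theorems.PIDim4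

end
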